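import Summits.Ventures.HodgeRepro2.T5SU11LegendreOrthogonalLower

/-!
# The Legendre expansion of a polynomial: `f = Σ_{k ≤ d} c_k P_k` with `c_k = ((2k + 1)/2) ∫_{−1}^{1} f P_k`,
Parseval, and the reproducing kernel

Every polynomial of degree `≤ d` is a combination of `P_0, …, P_d` (row 406,
`T5SU11LegendreOrthogonalLower.exists_eq_sum_C_mul_legPoly`), and the orthogonality `∫ P_j P_k = 2δ_{jk}/(2k + 1)`
(row 383) identifies the coefficients as the FOURIER–LEGENDRE COEFFICIENTS

  **`c_k(f) := ((2k + 1)/2) ∫_{−1}^{1} f(x) P_k(x) dx`**   (`legendreCoeff`),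
  **`f = Σ_{k ≤ d} c_k(f) · P_k` for `natDegree f ≤ d`**   (`eq_sum_legendreCoeff`),

so the coefficients of any expansion are forced (`coeff_eq_legendreCoeff`), vanish above the degree
(`legendreCoeff_eq_zero_of_lt`), and PARSEVAL holds:

  **`∫_{−1}^{1} f(x)² dx = Σ_{k ≤ d} 2 c_k(f)²/(2k + 1)`**   (`integral_sq_eq_sum`);

the polynomial kernel `K_d(x, y) = Σ_{k ≤ d} ((2k + 1)/2) P_k(x) P_k(y)` reproduces every polynomial of degree `≤ d`,
`∫_{−1}^{1} K_d(x, y) f(y) dy = f(x)` (`integral_kernel_mul_eq`). Nothing is claimed about (N).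

Blind lane: Mathlib + the HodgeRepro2 prefix only; no sorry; axioms ⊆ {propext, Classical.choice,
Quot.sound}.
-/

namespace Summit.Ventures.HodgeRepro2.T5SU11LegendreExpansion

open Polynomial intervalIntegral Finset
open T5SU11SphericalLegendreAll T5SU11JacobiPhaseLawEven T5SU11JacobiLegendreLeading T5SU11LegendreIdentities
  T5SU11LegendreOrthogonal T5SU11LegendreOrthogonalLower

/-- **The Fourier–Legendre coefficient** `c_k(f) = ((2k + 1)/2) ∫_{−1}^{1} f(x) P_k(x) dx`. -/
noncomputable def legendreCoeff (f : ℝ[X]) (k : ℕ) : ℝ :=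
  (2 * (k : ℝ) + 1) / 2 * ∫ x in (-1 : ℝ)..1, f.eval x * legP k x

/-- `∫_{−1}^{1} (Σ_{j ≤ d} c_j P_j)(x) P_k(x) dx = 2 c_k/(2k + 1)` for `k ≤ d`. -/
theorem integral_sum_mul_legP {d : ℕ} (c : ℕ → ℝ) {k : ℕ} (hk : k ≤ d) :
    ∫ x in (-1 : ℝ)..1, (∑ j ∈ range (d + 1), C (c j) * legPoly j).eval x * legP k x
      = c k * (2 / (2 * (k : ℝ) + 1)) := by
  simp_rw [eval_finsetSum, eval_mul, eval_C, Finset.sum_mul, ← legP_eq_eval]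
  have hint : ∀ j ∈ range (d + 1), IntervalIntegrable (fun x => c j * legP j x * legP k x)
      MeasureTheory.volume (-1 : ℝ) 1 := fun j _ =>
    ((continuous_const.mul (continuous_legP j)).mul (continuous_legP k)).intervalIntegrable _ _
  rw [integral_finsetSum hint, Finset.sum_eq_single k]
  · simp_rw [mul_assoc]
    rw [integral_const_mul, integral_legP_mul_legP k k, if_pos rfl]
  · intro j _ hjk
    simp_rw [mul_assoc]
    rw [integral_const_mul, integral_legP_mul_legP j k, if_neg hjk, mul_zero]
  · intro h
    exact absurd (Finset.mem_range.mpr (by omega)) h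

/-- **The coefficients of any expansion in `P_0, …, P_d` are the Fourier–Legendre coefficients.** -/
theorem coeff_eq_legendreCoeff {d : ℕ} {f : ℝ[X]} {c : ℕ → ℝ} (hf : f = ∑ j ∈ range (d + 1), C (c j) * legPoly j)
    {k : ℕ} (hk : k ≤ d) : c k = legendreCoeff f k := by
  rw [legendreCoeff, hf, integral_sum_mul_legP c hk]
  have : (2 * (k : ℝ) + 1) ≠ 0 := by positivity
  field_simp

/-- **THE LEGENDRE EXPANSION**: `f = Σ_{k ≤ d} c_k(f) P_k` for every polynomial `f` of degree `≤ d`. -/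
theorem eq_sum_legendreCoeff {d : ℕ} {f : ℝ[X]} (hf : f.natDegree ≤ d) :
    f = ∑ k ∈ range (d + 1), C (legendreCoeff f k) * legPoly k := by
  obtain ⟨c, hc⟩ := exists_eq_sum_C_mul_legPoly d f hf
  conv_lhs => rw [hc]
  refine Finset.sum_congr rfl fun k hk => ?_
  rw [coeff_eq_legendreCoeff hc (Nat.lt_succ_iff.mp (Finset.mem_range.mp hk))]

/-- The expansion, evaluated: `f(x) = Σ_{k ≤ d} c_k(f) P_k(x)`. -/
theorem eval_eq_sum_legendreCoeff {d : ℕ} {f : ℝ[X]} (hf : f.natDegree ≤ d) (x : ℝ) :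
    f.eval x = ∑ k ∈ range (d + 1), legendreCoeff f k * legP k x := by
  conv_lhs => rw [eq_sum_legendreCoeff hf]
  simp_rw [eval_finsetSum, eval_mul, eval_C, ← legP_eq_eval]

/-- **The coefficients vanish above the degree**: `c_k(f) = 0` for `natDegree f < k`. -/
theorem legendreCoeff_eq_zero_of_lt {f : ℝ[X]} {k : ℕ} (hk : f.natDegree < k) : legendreCoeff f k = 0 := by
  rw [legendreCoeff, integral_eval_mul_legP_eq_zero_of_natDegree_lt hk, mul_zero]

/-- **PARSEVAL for polynomials**: `∫_{−1}^{1} f(x)² dx = Σ_{k ≤ d} 2 c_k(f)²/(2k + 1)` for `natDegree f ≤ d`. -/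
theorem integral_sq_eq_sum {d : ℕ} {f : ℝ[X]} (hf : f.natDegree ≤ d) :
    ∫ x in (-1 : ℝ)..1, f.eval x ^ 2 = ∑ k ∈ range (d + 1), legendreCoeff f k ^ 2 * (2 / (2 * (k : ℝ) + 1)) := by
  have e : ∀ x, f.eval x ^ 2 = ∑ k ∈ range (d + 1), legendreCoeff f k * (f.eval x * legP k x) := fun x => by
    rw [sq]
    nth_rewrite 2 [eval_eq_sum_legendreCoeff hf x]
    rw [Finset.mul_sum]
    refine Finset.sum_congr rfl fun k _ => ?_
    ring
  simp_rw [e]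
  have hint : ∀ k ∈ range (d + 1), IntervalIntegrable (fun x => legendreCoeff f k * (f.eval x * legP k x))
      MeasureTheory.volume (-1 : ℝ) 1 := fun k _ =>
    (continuous_const.mul (f.continuous.mul (continuous_legP k))).intervalIntegrable _ _
  rw [integral_finsetSum hint]
  refine Finset.sum_congr rfl fun k hk => ?_
  rw [integral_const_mul]
  have hck : ∫ x in (-1 : ℝ)..1, f.eval x * legP k x = legendreCoeff f k * (2 / (2 * (k : ℝ) + 1)) := by
    rw [legendreCoeff]
    have : (2 * (k : ℝ) + 1) ≠ 0 := by positivity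
    field_simp
  rw [hck]
  ring

/-- **The reproducing kernel** `K_d(x, y) = Σ_{k ≤ d} ((2k + 1)/2) P_k(x) P_k(y)`. -/
noncomputable def kernel (d : ℕ) (x y : ℝ) : ℝ := ∑ k ∈ range (d + 1), (2 * (k : ℝ) + 1) / 2 * (legP k x * legP k y)

/-- **`∫_{−1}^{1} K_d(x, y) f(y) dy = f(x)`** for every polynomial `f` of degree `≤ d`. -/
theorem integral_kernel_mul_eq {d : ℕ} {f : ℝ[X]} (hf : f.natDegree ≤ d) (x : ℝ) :
    ∫ y in (-1 : ℝ)..1, kernel d x y * f.eval y = f.eval x := by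
  have e : ∀ y, kernel d x y * f.eval y
      = ∑ k ∈ range (d + 1), (2 * (k : ℝ) + 1) / 2 * legP k x * (f.eval y * legP k y) := fun y => by
    rw [kernel, Finset.sum_mul]
    refine Finset.sum_congr rfl fun k _ => ?_
    ring
  simp_rw [e]
  have hint : ∀ k ∈ range (d + 1), IntervalIntegrable
      (fun y => (2 * (k : ℝ) + 1) / 2 * legP k x * (f.eval y * legP k y)) MeasureTheory.volume (-1 : ℝ) 1 :=
    fun k _ => (continuous_const.mul (f.continuous.mul (continuous_legP k))).intervalIntegrable _ _
  rw [integral_finsetSum hint, eval_eq_sum_legendreCoeff hf x]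
  refine Finset.sum_congr rfl fun k _ => ?_
  rw [integral_const_mul, legendreCoeff]
  ring

/-- **Uniqueness of the expansion**: two polynomials of degree `≤ d` with the same Fourier–Legendre coefficients up
to `d` are equal. -/
theorem eq_of_legendreCoeff_eq {d : ℕ} {f g : ℝ[X]} (hf : f.natDegree ≤ d) (hg : g.natDegree ≤ d)
    (h : ∀ k ≤ d, legendreCoeff f k = legendreCoeff g k) : f = g := by
  rw [eq_sum_legendreCoeff hf, eq_sum_legendreCoeff hg]
  exact Finset.sum_congr rfl fun k hk => by rw [h k (Nat.lt_succ_iff.mp (Finset.mem_range.mp hk))]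

end Summit.Ventures.HodgeRepro2.T5SU11LegendreExpansion
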